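import Summits.NavierStokesRegularity.NavierStokesRegularity.Theorems.TypeIIInviscidRelaxationAxisymSwirlRegularZhangBarrierW
import Summits.NavierStokesRegularity.NavierStokesRegularity.Theorems.TypeIIInviscidRelaxationAxisymSwirlRegularZhangPartialTypeIOfBarrier
import Summits.NavierStokesRegularity.NavierStokesRegularity.Theorems.TypeIIInviscidRelaxationAxisymSwirlRegularSimilarityTools
import HarnessLib

/-!
# The κ-inflow gates (`0 < κ < 1`) on a thin tube and near the blow-up time only

Helper toward the crux `AxisymSwirlRegular` (stmt-NavierStokesRegularity-1964, route TypeIIInviscidRelaxation),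
criterion side of the registered line `radial_inflow_split` (stub `stub_oneSidedRadialCriterion`, ⟨19059⟩).

The landed κ-inflow criterion `hasSmoothExtensionPast_of_kappaEnvelope_holds` (ns-idea-4 / hand 2-g1: for `0 < κ ≤ 1`,
`M > 0`, the one-sided gate `u_r ≥ −M ν^{1−κ/2} r^{κ−1} (T−t)^{−κ/2}` on the UNIT tube `0 < r ≤ 1` for ALL `t ∈ [0,T)`
implies continuation past `T`) is upgraded, for `κ < 1`, to hypotheses on a tube of ANY radius `δ` and only from ANY
time `T₁ < T` on: the envelope blows up at the axis like `r^{κ−1}`, so on a thin enough tube (radius set by the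
sub-slab velocity bound up to `max T₁ 0`, `RadialInflowComparisonT.exists_bound_subslab`) the gate holds trivially at
the early times, and the gate is invariant under Leray's similarity `u ↦ c u(c²·, c·)`, which maps the thin tube onto
the unit tube (`RadialInflowSimilarity.standingClass_nsRescale`, `…hasSmoothExtensionPast_of_nsRescale`,
`…radialVelocity_nsRescale`).  (At `κ = 1` — Q. S. Zhang's partial Type I gate — the envelope is bounded at the axis
and this device does not apply.)

* `hasSmoothExtensionPast_of_kappaEnvelope_tube_nearTop` — the criterion;
* `exists_kappaEnvelope_violation_nearTop` — blow-up reading: a non-extending solution of the standing class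
  violates EVERY κ-gate (`0<κ<1`, `M>0`) on every tube `{r ≤ δ}` at times arbitrarily close to `T`.

Criteria; nothing here proves `stub_oneSidedRadialCriterion`, `AxisymSwirlRegular` or NavierStokesRegularity. [new]
-/

noncomputable section

set_option linter.dupNamespace false

open Set Filter Topology Real
open Literature.Analysis.FluidPDE

namespace Summit.NavierStokesRegularity.NavierStokesRegularity.Theorems.RadialInflowSimilarity

open Summit.NavierStokesRegularity.NavierStokesRegularity.Theorems
open Summit.NavierStokesRegularity.NavierStokesRegularity.Theorems.ScenarioCensus.LogGate

/-- The κ-envelope is invariant under Leray's similarity: for `c > 0`, `r, S' > 0`,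
`c · (c r)^{κ−1} (c² S')^{−κ/2} = r^{κ−1} S'^{−κ/2}`. -/
theorem kappaEnvelope_similarity {κ c r S' : ℝ} (hc : 0 < c) (hr : 0 < r) (hS : 0 < S') :
    c * ((c * r) ^ (κ - 1) * (c ^ 2 * S') ^ (-(κ / 2))) = r ^ (κ - 1) * S' ^ (-(κ / 2)) := by
  rw [Real.mul_rpow hc.le hr.le, Real.mul_rpow (pow_pos hc 2).le hS.le]
  have h1 : (c ^ 2 : ℝ) ^ (-(κ / 2)) = c ^ (-κ) := by
    rw [show (c ^ 2 : ℝ) = c ^ (2 : ℝ) by norm_cast, ← Real.rpow_mul hc.le]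
    congr 1; ring
  rw [h1]
  have h2 : c * (c ^ (κ - 1)) * c ^ (-κ) = 1 := by
    rw [show c * c ^ (κ - 1) = c ^ (1 : ℝ) * c ^ (κ - 1) by rw [Real.rpow_one], ← Real.rpow_add hc,
      ← Real.rpow_add hc]
    rw [show (1 : ℝ) + (κ - 1) + -κ = 0 by ring, Real.rpow_zero]
  calc c * (c ^ (κ - 1) * r ^ (κ - 1) * (c ^ (-κ) * S' ^ (-(κ / 2))))
      = (c * c ^ (κ - 1) * c ^ (-κ)) * (r ^ (κ - 1) * S' ^ (-(κ / 2))) := by ring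
    _ = r ^ (κ - 1) * S' ^ (-(κ / 2)) := by rw [h2, one_mul]

/-- **κ-inflow criterion on a thin tube near the blow-up time** (`0 < κ < 1`, `M > 0`). For a classical solution on
`[0,T)` at viscosity `ν`, Leray–Hopf from a rapidly decaying datum, with axisymmetric slices: if for SOME `δ > 0` and
SOME `T₁ < T` the one-sided gate `u_r ≥ −M ν^{1−κ/2} r^{κ−1} (T−t)^{−κ/2}` holds on `{0 < r ≤ δ} × [max T₁ 0, T)`, the
solution extends smoothly past `T`.  Proof: with `B` the velocity bound on `[0, max T₁ 0]`
(`RadialInflowComparisonT.exists_bound_subslab`) and `A = M ν^{1−κ/2} T^{−κ/2}/(max B 0 + 1)`, on the tube of radius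
`c = min δ (min 1 A^{1/(1−κ)})` the envelope exceeds `max B 0 + 1 ≥ −u_r` at the early times, so the gate holds on
`{0 < r ≤ c} × [0,T)`; Leray's similarity with `c` gives the unit-tube gate for `c u(c²·, c·)` on `[0, T/c²)`
(`kappaEnvelope_similarity`), `hasSmoothExtensionPast_of_kappaEnvelope_holds` continues it, and the continuation pulls
back. [new] -/
theorem hasSmoothExtensionPast_of_kappaEnvelope_tube_nearTop {κ M ν T δ T₁ : ℝ}
    {u : ℝ → EuclideanSpace ℝ (Fin 3) → EuclideanSpace ℝ (Fin 3)} {p : ℝ → EuclideanSpace ℝ (Fin 3) → ℝ}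
    (hκ0 : 0 < κ) (hκ1 : κ < 1) (hM : 0 < M) (hν : 0 < ν) (hT : 0 < T)
    (hcl : IsClassicalNSSolutionOn (Ico 0 T) ν 0 u p) (hLH : IsLerayHopfOn T ν 0 (u 0) u)
    (hdec : HasRapidSpatialDecay (u 0)) (hax : ∀ t ∈ Ico 0 T, IsAxisymmetric (u t))
    (hδ : 0 < δ) (hT₁ : T₁ < T)
    (henv : ∀ t ∈ Ico 0 T, T₁ ≤ t → ∀ x : EuclideanSpace ℝ (Fin 3), 0 < cylRadius x → cylRadius x ≤ δ →
      -(M * ν ^ (1 - κ / 2) * cylRadius x ^ (κ - 1) * (T - t) ^ (-(κ / 2))) ≤ radialVelocity (u t) x) :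
    HasSmoothExtensionPast ν 0 u T := by
  -- the early bound and the thin tube
  set T₀ : ℝ := max T₁ 0 with hT₀_def
  have hT₀T : T₀ < T := max_lt hT₁ hT
  obtain ⟨B, hB⟩ := RadialInflowComparisonT.exists_bound_subslab hν hT hcl hLH hdec T₀ hT₀T
  set B' : ℝ := max B 0 + 1 with hB'_def
  have hB'0 : 0 < B' := by rw [hB'_def]; positivity
  have hBB' : B ≤ B' := by rw [hB'_def]; linarith [le_max_left B 0]
  have hνp : 0 < ν ^ (1 - κ / 2) := Real.rpow_pos_of_pos hν _
  have hTp : 0 < T ^ (-(κ / 2)) := Real.rpow_pos_of_pos hT _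
  set A : ℝ := M * ν ^ (1 - κ / 2) * T ^ (-(κ / 2)) / B' with hA_def
  have hA : 0 < A := by rw [hA_def]; positivity
  have h1κ : 0 < 1 - κ := by linarith
  set c : ℝ := min δ (min 1 (A ^ (1 / (1 - κ)))) with hc_def
  have hc : 0 < c := lt_min hδ (lt_min one_pos (Real.rpow_pos_of_pos hA _))
  have hcδ : c ≤ δ := min_le_left _ _
  have hcA : c ≤ A ^ (1 / (1 - κ)) := (min_le_right _ _).trans (min_le_right _ _)
  -- on the thin tube the envelope dominates `B'` at early times
  have henv_big : ∀ t ∈ Ico 0 T, ∀ r : ℝ, 0 < r → r ≤ c →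
      B' ≤ M * ν ^ (1 - κ / 2) * r ^ (κ - 1) * (T - t) ^ (-(κ / 2)) := by
    intro t ht r hr hrc
    have hs : 0 < T - t := by linarith [ht.2]
    have hr1 : A⁻¹ ≤ r ^ (κ - 1) := by
      have h1 : (A ^ (1 / (1 - κ))) ^ (κ - 1) ≤ r ^ (κ - 1) :=
        Real.rpow_le_rpow_of_nonpos hr (hrc.trans hcA) (by linarith)
      have h2 : (A ^ (1 / (1 - κ))) ^ (κ - 1) = A⁻¹ := by
        rw [← Real.rpow_mul hA.le, show 1 / (1 - κ) * (κ - 1) = -1 by field_simp; ring, Real.rpow_neg_one]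
      rwa [h2] at h1
    have hs1 : T ^ (-(κ / 2)) ≤ (T - t) ^ (-(κ / 2)) :=
      Real.rpow_le_rpow_of_nonpos hs (by linarith [ht.1]) (by linarith)
    have hMν : 0 ≤ M * ν ^ (1 - κ / 2) := by positivity
    calc B' = M * ν ^ (1 - κ / 2) * A⁻¹ * T ^ (-(κ / 2)) := by
          rw [hA_def]; field_simp
      _ ≤ M * ν ^ (1 - κ / 2) * r ^ (κ - 1) * (T - t) ^ (-(κ / 2)) := by
          refine mul_le_mul (mul_le_mul_of_nonneg_left hr1 hMν) hs1 hTp.le ?_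
          exact mul_nonneg hMν (Real.rpow_nonneg hr.le _)
  -- the gate on `{0 < r ≤ c} × [0, T)`
  have hgate : ∀ t ∈ Ico 0 T, ∀ x : EuclideanSpace ℝ (Fin 3), 0 < cylRadius x → cylRadius x ≤ c →
      -(M * ν ^ (1 - κ / 2) * cylRadius x ^ (κ - 1) * (T - t) ^ (-(κ / 2))) ≤ radialVelocity (u t) x := by
    intro t ht x hx hxc
    by_cases htT₀ : t < T₀
    · have hu : ‖u t x‖ ≤ B' := (hB t ⟨ht.1, htT₀.le⟩ x).trans hBB'
      have h1 := neg_norm_le_radialVelocity (u t) hx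
      have h2 := henv_big t ht (cylRadius x) hx hxc
      linarith
    · push Not at htT₀
      exact henv t ht ((le_max_left _ _).trans htT₀) x hx (hxc.trans hcδ)
  -- Leray's similarity with `c`
  have hc2 : 0 < c ^ 2 := pow_pos hc 2
  have hTc : 0 < T / c ^ 2 := div_pos hT hc2
  obtain ⟨hclw, hLHw, hdecw, haxw⟩ := standingClass_nsRescale hT hcl hLH hdec hax hc
  have hrad : ∀ y : EuclideanSpace ℝ (Fin 3), cylRadius (c • y) = c * cylRadius y := fun y => by
    rw [cylRadius_smul, abs_of_pos hc]
  have hextw : HasSmoothExtensionPast ν 0 (nsRescale c u) (T / c ^ 2) := by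
    refine hasSmoothExtensionPast_of_kappaEnvelope_holds hκ0 hκ1.le hM hν hTc hclw hLHw hdecw haxw
      fun s hs y hy hy1 => ?_
    have ht : c ^ 2 * s ∈ Ico 0 T := ⟨mul_nonneg hc2.le hs.1, (lt_div_iff₀' hc2).1 hs.2⟩
    have hS : 0 < T / c ^ 2 - s := by linarith [hs.2]
    have hx : 0 < cylRadius (c • y) := by rw [hrad]; exact mul_pos hc hy
    have hxc : cylRadius (c • y) ≤ c := by rw [hrad]; nlinarith
    have h1 := hgate (c ^ 2 * s) ht (c • y) hx hxc
    rw [radialVelocity_nsRescale hc, hrad] at *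
    have e : T - c ^ 2 * s = c ^ 2 * (T / c ^ 2 - s) := by field_simp
    rw [e] at h1
    have key := kappaEnvelope_similarity (κ := κ) hc hy hS
    -- `c · envelope(t, x) = envelope'(s, y)`
    have h2 : c * (M * ν ^ (1 - κ / 2) * (c * cylRadius y) ^ (κ - 1) * (c ^ 2 * (T / c ^ 2 - s)) ^ (-(κ / 2)))
        = M * ν ^ (1 - κ / 2) * cylRadius y ^ (κ - 1) * (T / c ^ 2 - s) ^ (-(κ / 2)) := by
      calc c * (M * ν ^ (1 - κ / 2) * (c * cylRadius y) ^ (κ - 1) * (c ^ 2 * (T / c ^ 2 - s)) ^ (-(κ / 2)))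
          = M * ν ^ (1 - κ / 2) * (c * ((c * cylRadius y) ^ (κ - 1) * (c ^ 2 * (T / c ^ 2 - s)) ^ (-(κ / 2)))) := by
            ring
        _ = M * ν ^ (1 - κ / 2) * (cylRadius y ^ (κ - 1) * (T / c ^ 2 - s) ^ (-(κ / 2))) := by rw [key]
        _ = _ := by ring
    rw [← h2]
    nlinarith
  exact hasSmoothExtensionPast_of_nsRescale hc hextw

/-- **Blow-up reading**: a solution of the standing class that does NOT extend past `T` violates every κ-gate
(`0 < κ < 1`, `M > 0`) on every tube `{r ≤ δ}` at times arbitrarily close to `T`: for every `T₁ < T` there are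
`t ∈ [T₁,T) ∩ [0,T)` and `x` with `0 < r ≤ δ` and `u_r(t,x) < −M ν^{1−κ/2} r^{κ−1} (T−t)^{−κ/2}`. [new] -/
theorem exists_kappaEnvelope_violation_nearTop {κ M ν T δ T₁ : ℝ}
    {u : ℝ → EuclideanSpace ℝ (Fin 3) → EuclideanSpace ℝ (Fin 3)} {p : ℝ → EuclideanSpace ℝ (Fin 3) → ℝ}
    (hκ0 : 0 < κ) (hκ1 : κ < 1) (hM : 0 < M) (hν : 0 < ν) (hT : 0 < T)
    (hcl : IsClassicalNSSolutionOn (Ico 0 T) ν 0 u p) (hLH : IsLerayHopfOn T ν 0 (u 0) u)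
    (hdec : HasRapidSpatialDecay (u 0)) (hax : ∀ t ∈ Ico 0 T, IsAxisymmetric (u t))
    (hno : ¬ HasSmoothExtensionPast ν 0 u T) (hδ : 0 < δ) (hT₁ : T₁ < T) :
    ∃ t ∈ Ico 0 T, T₁ ≤ t ∧ ∃ x : EuclideanSpace ℝ (Fin 3), 0 < cylRadius x ∧ cylRadius x ≤ δ ∧
      radialVelocity (u t) x < -(M * ν ^ (1 - κ / 2) * cylRadius x ^ (κ - 1) * (T - t) ^ (-(κ / 2))) := by
  by_contra hcon
  push Not at hcon
  exact hno (hasSmoothExtensionPast_of_kappaEnvelope_tube_nearTop hκ0 hκ1 hM hν hT hcl hLH hdec hax hδ hT₁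
    fun t ht htT₁ x hx hxδ => hcon t ht htT₁ x hx hxδ)

end Summit.NavierStokesRegularity.NavierStokesRegularity.Theorems.RadialInflowSimilarity

end
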